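import Literature.NumberTheory.EllipticCurves.IwasawaAlgebraCharIdealProofs
import Literature.NumberTheory.EllipticCurves.IwasawaAlgebraStructureProofs
import HarnessLib

/-!
# `μ(M) = 0` iff `p` does not divide a characteristic power series of `M`

Theorems only (no new definitions, no named facts). For a finitely generated torsion module `M`
over the Iwasawa algebra `Λ = ℤ_p⟦T⟧` whose characteristic ideal is `(g)`, the `μ`-invariant of
`M` (the tree's INTRINSIC definition `Literature.NumberTheory.EllipticCurves.muInvariant`: the
local length of `M` at the height-one prime `(p)`) vanishes if and only if `p ∤ g` in `Λ`, i.e.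
iff some coefficient of `g` is a `p`-adic unit.  This is the sentence following display (2) of
R. Greenberg, V. Vatsal, *On the Iwasawa invariants of elliptic curves*, Invent. Math. 142 (2000),
p. 2 — "Thus `p^{μ^alg_E}` is the exact power of `p` dividing `f^alg_E(T)` in `Λ`" (for the
characteristic polynomial `f^alg_E = p^{μ} ∏ fᵢ^{aᵢ}` of `X_E(ℚ_∞)`) — in its `μ = 0` case, proved
for the intrinsic `μ`; it is the bridge between the module-side `μ`-invariant (`SelmerDualData.mu`)
and the power-series reading "unit content of a generator of `char X`" used when main-conjecture
statements are written as `char X = (g)`, `ι g = L_p` (cell `b2b-bsdres`,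
`GreenbergVatsal2000/CongruentCurves.lean`: `HasUnitContent g := ∃ n, IsUnit (coeff n g)`).

Proof (Washington §13.2 bookkeeping, all inputs already in the tree): by the structure theorem
(`exists_isPseudoIsomorphism_elementary_holds`) `M ∼ E(μs, fs)` with distinguished `fⱼ`; then
`char M = (p^{∑ μᵢ} ∏ fⱼ^{nⱼ})` (`charIdeal_eq_span_holds`) and `μ(M) = ∑ μᵢ`
(`muInvariant_eq_sum_holds`); `p` is prime in `Λ` (`IwasawaAlgebra.prime_C`) and divides no
distinguished polynomial (`coe_notMem_augIdealP_of_isDistinguishedAt`), so `p ∣ p^{∑ μᵢ} ∏ fⱼ^{nⱼ}`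
iff `∑ μᵢ ≠ 0`; finally two generators of the same principal ideal of the domain `Λ` are associated.

## References
* L. Washington, *Introduction to Cyclotomic Fields*, §13.2 (after Thm. 13.12). [Washington1997]
* R. Greenberg, V. Vatsal, Invent. Math. 142 (2000) 17–63, p. 2, (1)–(2). [GreenbergVatsal2000]
-/

set_option autoImplicit false

noncomputable section

open scoped Polynomial

namespace Literature.NumberTheory.EllipticCurves

section MuVanishing

open IwasawaAlgebra EllipticCurves.Module

variable {p : ℕ} [Fact p.Prime]

/-- `p ∣ p^{∑ μᵢ} · ∏ fⱼ^{nⱼ}` in `Λ` iff `∑ μᵢ ≠ 0`, for distinguished `fⱼ` (`p` is prime in `Λ`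
and divides no distinguished polynomial). [cite: Washington1997, §13.2] -/
theorem C_dvd_charElement_iff {μs : List ℕ} {fs : List (ℤ_[p][X] × ℕ)}
    (hfs : ∀ f ∈ fs, f.1.IsDistinguishedAt (IsLocalRing.maximalIdeal ℤ_[p])) :
    PowerSeries.C (p : ℤ_[p]) ∣ charElement p μs fs ↔ μs.sum ≠ 0 := by
  constructor
  · intro hdvd hsum
    rw [charElement, hsum, pow_zero, map_one, one_mul] at hdvd
    obtain ⟨x, hx, hpx⟩ := (prime_C p).exists_mem_multiset_dvd
      (by rwa [← Multiset.prod_coe, ← Multiset.map_coe] at hdvd)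
    rw [Multiset.map_coe, Multiset.mem_coe, List.mem_map] at hx
    obtain ⟨f, hf, rfl⟩ := hx
    have hpf : PowerSeries.C (p : ℤ_[p]) ∣ (f.1 : IwasawaAlgebra p) :=
      (prime_C p).dvd_of_dvd_pow hpx
    exact coe_notMem_augIdealP_of_isDistinguishedAt p (hfs f hf)
      (by rw [augIdealP, Ideal.mem_span_singleton]; exact hpf)
  · intro hsum
    obtain ⟨k, hk⟩ := Nat.exists_eq_succ_of_ne_zero hsum
    rw [charElement, hk, pow_succ, map_mul]
    exact Dvd.dvd.mul_right (Dvd.intro_left _ rfl) _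

/-- **`μ(M) = 0 ⟺ p ∤ g` for a generator `g` of the characteristic ideal** (Greenberg–Vatsal 2000,
p. 2, after (2): "`p^{μ}` is the exact power of `p` dividing" the characteristic power series; here
for the intrinsic `μ = length_{Λ_(p)} M_(p)` of `IwasawaAlgebra.lean` and a finitely generated
torsion `Λ`-module `M`). [cite: GreenbergVatsal2000, p. 2, (1)–(2)] [cite: Washington1997, §13.2] -/
theorem muInvariant_eq_zero_iff_not_C_dvd_of_charIdeal_eq_span
    (M : Type*) [AddCommGroup M] [_root_.Module (IwasawaAlgebra p) M]
    [Module.Finite (IwasawaAlgebra p) M] (hM : Module.IsTorsion (IwasawaAlgebra p) M)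
    {g : IwasawaAlgebra p} (hg : charIdeal (IwasawaAlgebra p) M = Ideal.span {g}) :
    muInvariant p M = 0 ↔ ¬ PowerSeries.C (p : ℤ_[p]) ∣ g := by
  obtain ⟨μs, fs, -, hfs, hψ⟩ := exists_isPseudoIsomorphism_elementary_holds p M hM
  have hfs' : ∀ f ∈ fs, f.1.IsDistinguishedAt (IsLocalRing.maximalIdeal ℤ_[p]) :=
    fun f hf => (hfs f hf).1
  have hchar : charIdeal (IwasawaAlgebra p) M = Ideal.span {charElement p μs fs} :=
    charIdeal_eq_span_holds p M hfs' hψ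
  have hμ : muInvariant p M = μs.sum := muInvariant_eq_sum_holds p M hfs' hψ
  -- `g` and the characteristic element generate the same ideal, hence are associated
  obtain ⟨u, hu⟩ := Ideal.span_singleton_eq_span_singleton.mp (hg.symm.trans hchar)
  rw [hμ, ← not_ne_iff, ← C_dvd_charElement_iff hfs', ← hu, Units.dvd_mul_right]

/-- **`μ(M) = 0 ⟺` some coefficient of a characteristic power series is a unit** (unit content
of the generator; the same statement read coefficientwise in `ℤ_p`). [cite: GreenbergVatsal2000, p. 2, (1)–(2)] [cite: Washington1997, §13.2] -/
theorem muInvariant_eq_zero_iff_exists_isUnit_coeff_of_charIdeal_eq_span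
    (M : Type*) [AddCommGroup M] [_root_.Module (IwasawaAlgebra p) M]
    [Module.Finite (IwasawaAlgebra p) M] (hM : Module.IsTorsion (IwasawaAlgebra p) M)
    {g : IwasawaAlgebra p} (hg : charIdeal (IwasawaAlgebra p) M = Ideal.span {g}) :
    muInvariant p M = 0 ↔ ∃ n : ℕ, IsUnit (PowerSeries.coeff n g) := by
  rw [muInvariant_eq_zero_iff_not_C_dvd_of_charIdeal_eq_span M hM hg,
    PowerSeries.C_dvd_iff_forall_dvd_coeff, not_forall]
  refine exists_congr fun n => ?_
  rw [PadicInt.isUnit_iff, ← PadicInt.norm_lt_one_iff_dvd, not_lt]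
  exact ⟨fun h => le_antisymm (PadicInt.norm_le_one _) h, fun h => h.ge⟩

end MuVanishing

end Literature.NumberTheory.EllipticCurves

end
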